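/-
Copyright (c) 2026 the pub-hodgecm-mathlib formalisation cell (harness21).  Prover seat hodgecm-mathlib-K2Liu-p09 (g0): Track B «K2-LIT»,
#184♮ = hLiu418 = stmt-HodgeConjecture-24832, file #9 of the K2_Liu road, organ (III-b) step E5′ (B3b: centre scaling of the Haar measure of `N_Δ`); 2026-09-04.
-/
import Summits.HodgeConjecture.HodgeConjecture.Theorems.K2LiuSiegelDoubledUnipotentChart   -- ★ B3a `exists_unipotentChart`
import Literature.MeasureTheory.Group.ModularCharacterSemidirect                           -- ★ `IsTopSemidirect.map_conjBy_eq_smul`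
import Literature.NumberTheory.Automorphic.IdeleModuleProofs                               -- ★ `AdeleRing.addHaar_smul_eq_ideleNorm_mul`
import Literature.NumberTheory.Automorphic.IdeleNormGalConj                                 -- ★ `ideleNorm_unitsMap_galRingHom`
import Literature.NumberTheory.Automorphic.AdelicSecondCountable                            -- ★ `secondCountableTopology_adeleRing`
import Literature.NumberTheory.Automorphic.AdicCompletionCompact                            -- ★ `locallyCompactSpace_adeleRing'`
import Summits.HodgeConjecture.HodgeConjecture.Theorems.K2LiuSiegelDoubledParabolicReduction -- ★ `isClosed_siegelDelta`
import HarnessLib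

/-!
# Crux `HLiu418`, road `K2_Liu`, U3a file #9 — helper 17 (E5′ part B3b): THE CENTRE SCALING of the Haar measure of `N_Δ(𝔸)`,
# `((φ z(eˢ))⁻¹ · φ z(eˢ))_* μ_N = e^{n² [L:ℚ] s} μ_N` (the SQUARING TRICK)

Cell `hodgecm-mathlib`, crux hLiu418 = `stmt-HodgeConjecture-24832`; prover K2Liu-p09 (g0).  THEOREMS ONLY; `--supports stmt-HodgeConjecture-24832`
(hypothesis `hscale` of ★ `godement_parabolic_integral` with the EXACT exponent `c₀ = n² [L:ℚ]`; socket #9).  With the unipotent chart `υ`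
(★ `exists_unipotentChart`) and `δ ∈ L`, `c δ = −δ`: `Ψ X = (υ X, υ (δ⁻¹ X)) : M_n(𝔸_L) ≃ₜ N_Δ × N_Δ` is additive-to-multiplicative
(★ `self_eq_proj_add_smul_proj`) and intertwines `X ↦ c_s⁻¹ X` with `conj × conj` (`exists_squaringChart`); so if `conj_* μ_N = θ μ_N`
(★ `map_conjBy_eq_smul`) then `μ_V = Ψ⁻¹_* (μ_N ⊗ μ_N)` is an additive Haar measure of `M_n(𝔸_L)` with `(c_s⁻¹ ·)_* μ_V = θ² μ_V`, while
every additive Haar measure of `M_n(𝔸_L)` scales by `|c_s|_𝔸^{n²}` (Tate's `d(ax) = |a| dx` per coordinate, `pi_map_inv_smul_eq`, Haar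
uniqueness); `|c_s| = |r|·|(c⊗1) r| = e^{2[L:ℚ]s}`, hence `θ = e^{n²[L:ℚ]s}` (`exists_haar_conjBy_scaling`).
[Garrett (2018) §3.10; Moeglin–Waldspurger I.1.4, II.1.5; Tate (1967) Lemma 4.1.2.]

HONEST LABEL.  Count-neutral helper; it retires nothing by itself: `HC_CM` is proved only modulo the 7 printed citations (2 remaining named
inputs: hLiu418 = `stmt-HodgeConjecture-24832`, h413 = `stmt-HodgeConjecture-24833`) until rung 0 closes.
-/

set_option autoImplicit false
-- the mandated namespace repeats the single-problem summit's segment (`HodgeConjecture.HodgeConjecture`)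
set_option linter.dupNamespace false

noncomputable section

open scoped Matrix NNReal ENNReal Pointwise
open NumberField IsDedekindDomain MeasureTheory Measure

namespace Summit.HodgeConjecture.HodgeConjecture.Cruxes.HLiu418.K2LiuSiegelDoubledUnipotentScaling

open Literature.NumberTheory.GelbartRogawski1991.AdaptedBlocks
open Literature.NumberTheory.Automorphic Literature.NumberTheory.Automorphic.UnitaryGroup
open Literature.NumberTheory.GelbartRogawski1991 Literature.NumberTheory.GelbartRogawski1991.GRConstruction
open Literature.NumberTheory.K2Lit.SiegelDoubled Literature.NumberTheory.GaloisRepresentations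
open UnitaryDualPair
open Summit.HodgeConjecture.HodgeConjecture.Cruxes.HLiu418.K2LiuSiegelDoubledLeviAlgebra
open Summit.HodgeConjecture.HodgeConjecture.Cruxes.HLiu418.K2LiuSiegelDoubledBlkUnitary
open Summit.HodgeConjecture.HodgeConjecture.Cruxes.HLiu418.K2LiuSiegelDoubledLeviMatrix
open Summit.HodgeConjecture.HodgeConjecture.Cruxes.HLiu418.K2LiuSiegelDoubledLeviChart
open Summit.HodgeConjecture.HodgeConjecture.Cruxes.HLiu418.K2LiuSiegelDoubledUnipotentChart
open Summit.HodgeConjecture.HodgeConjecture.Cruxes.HLiu418.K2LiuSiegelDoubledParabolicReduction (isClosed_siegelDelta)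

/-! ## §1 Transport of a product Haar measure along an additive-to-multiplicative chart -/

section Transport

variable {Nt V : Type*} [Group Nt] [TopologicalSpace Nt] [MeasurableSpace Nt] [BorelSpace Nt]
  [AddCommGroup V] [TopologicalSpace V] [IsTopologicalAddGroup V] [MeasurableSpace V] [BorelSpace V]

omit [Group Nt] [AddCommGroup V] [IsTopologicalAddGroup V] in
/-- **Scaling transported along a chart.**  `Ψ : V ≃ₜ N × N`, `cb : N → N` and `m : V → V` measurable with `Ψ ∘ m = (cb × cb) ∘ Ψ`, and
`cb_* μ = θ μ`; then `m_* (Ψ⁻¹_* (μ ⊗ μ)) = θ² · Ψ⁻¹_* (μ ⊗ μ)`. [folklore] -/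
theorem map_transport_eq_smul [SecondCountableTopology Nt] (μ : Measure Nt) [SFinite μ] (Ψ : V ≃ₜ Nt × Nt)
    {cb : Nt → Nt} (hcb : Measurable cb) {θ : ℝ≥0∞} (hμ : μ.map cb = θ • μ)
    {m : V → V} (hm : Measurable m) (hΨm : ∀ x, Ψ (m x) = (cb (Ψ x).1, cb (Ψ x).2)) :
    ((μ.prod μ).map Ψ.symm).map m = (θ * θ) • (μ.prod μ).map Ψ.symm := by
  have hΨs : Measurable Ψ.symm := Ψ.symm.continuous.measurable
  have hcomp : m ∘ Ψ.symm = Ψ.symm ∘ Prod.map cb cb := by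
    funext y
    apply Ψ.injective
    simp only [Function.comp_apply, Homeomorph.apply_symm_apply, hΨm, Prod.map]
  rw [map_map hm hΨs, hcomp, ← map_map hΨs (hcb.prodMap hcb), ← map_prod_map μ μ hcb hcb, hμ,
    Measure.prod_smul_left, Measure.prod_smul_right, smul_smul, Measure.map_smul]

/-- **The transported product measure is additively left invariant** when `Ψ (x + y) = Ψ x · Ψ y` and `μ` is left invariant. [folklore] -/
theorem isAddLeftInvariant_transport [IsTopologicalGroup Nt] [SecondCountableTopology Nt] (μ : Measure Nt) [SFinite μ] [μ.IsMulLeftInvariant]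
    (Ψ : V ≃ₜ Nt × Nt) (hΨ : ∀ x y, Ψ (x + y) = Ψ x * Ψ y) :
    ((μ.prod μ).map Ψ.symm).IsAddLeftInvariant := by
  have hΨs : Measurable Ψ.symm := Ψ.symm.continuous.measurable
  refine ⟨fun x₀ => ?_⟩
  have hcomp : (fun x => x₀ + x) ∘ Ψ.symm = Ψ.symm ∘ fun y => Ψ x₀ * y := by
    funext y
    apply Ψ.injective
    simp only [Function.comp_apply, Homeomorph.apply_symm_apply, hΨ]
  rw [map_map (measurable_const_add x₀) hΨs, hcomp, ← map_map hΨs (measurable_const_mul _), map_mul_left_eq_self]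

omit [Group Nt] [IsTopologicalAddGroup V] [AddCommGroup V] in
/-- The transported product measure is finite on compacts. [folklore] -/
theorem isFiniteMeasureOnCompacts_transport [SecondCountableTopology Nt] [T2Space V] (μ : Measure Nt) [IsFiniteMeasureOnCompacts μ]
    (Ψ : V ≃ₜ Nt × Nt) :
    IsFiniteMeasureOnCompacts ((μ.prod μ).map Ψ.symm) := by
  refine ⟨fun K hK => ?_⟩
  rw [map_apply Ψ.symm.continuous.measurable hK.measurableSet, ← Homeomorph.image_eq_preimage_symm]
  exact (hK.image Ψ.continuous).measure_lt_top

end Transport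

/-! ## §2 Additive Haar measures on `M_n(𝔸_K)` scale by `|c|_𝔸^{n²}` -/

section Pi

variable {α : Type*} [MeasurableSpace α]

/-- **Product scaling.**  If `f_* μ = t μ` (`0 < t < ∞`) then the coordinatewise map on `Fin m → α` scales the product measure by `t^m`
(uniqueness of product measures on boxes, Mathlib `Measure.pi_eq`). [folklore] -/
theorem pi_map_eq_pow_smul (μ : Measure α) [SigmaFinite μ] {f : α → α} (hf : Measurable f) {t : ℝ≥0∞} (ht0 : t ≠ 0) (htop : t ≠ ∞)
    (h : μ.map f = t • μ) (m : ℕ) :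
    (Measure.pi fun _ : Fin m => μ).map (fun x : Fin m → α => fun i => f (x i)) = t ^ m • Measure.pi fun _ : Fin m => μ := by
  have hF : Measurable (fun x : Fin m → α => fun i => f (x i)) := measurable_pi_lambda _ fun i => hf.comp (measurable_pi_apply i)
  have key : Measure.pi (fun _ : Fin m => μ) = (t ^ m)⁻¹ • (Measure.pi fun _ : Fin m => μ).map (fun x : Fin m → α => fun i => f (x i)) := by
    refine Measure.pi_eq fun s hs => ?_
    rw [Measure.smul_apply, smul_eq_mul, map_apply hF (MeasurableSet.univ_pi hs)]
    have hpre : (fun x : Fin m → α => fun i => f (x i)) ⁻¹' Set.pi Set.univ s = Set.pi Set.univ fun i => f ⁻¹' (s i) := by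
      ext x; simp
    rw [hpre, Measure.pi_pi]
    have hi : ∀ i, μ (f ⁻¹' s i) = t * μ (s i) := fun i => by rw [← map_apply hf (hs i), h, Measure.smul_apply, smul_eq_mul]
    simp_rw [hi]
    rw [Finset.prod_mul_distrib, Finset.prod_const, Finset.card_univ, Fintype.card_fin, ← mul_assoc,
      ENNReal.inv_mul_cancel (pow_ne_zero _ ht0) (ENNReal.pow_ne_top htop), one_mul]
  calc (Measure.pi fun _ : Fin m => μ).map (fun x : Fin m → α => fun i => f (x i))
      = (t ^ m * (t ^ m)⁻¹) • (Measure.pi fun _ : Fin m => μ).map (fun x : Fin m → α => fun i => f (x i)) := by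
        rw [ENNReal.mul_inv_cancel (pow_ne_zero _ ht0) (ENNReal.pow_ne_top htop), one_smul]
    _ = t ^ m • ((t ^ m)⁻¹ • (Measure.pi fun _ : Fin m => μ).map (fun x : Fin m → α => fun i => f (x i))) := by rw [smul_smul]
    _ = t ^ m • Measure.pi fun _ : Fin m => μ := by rw [← key]

end Pi

section Adelic

variable (K : Type) [Field K] [NumberField K] (n : ℕ)

/-- **The idele module of `M_n(𝔸_K)`.**  For the product Haar measure `μ_pi = ⊗_{i,j} μ₁` on `M_n(𝔸_K) = (Fin n → Fin n → 𝔸_K)` (`μ₁` a regular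
additive Haar measure on `𝔸_K`) and an idele `c`: `(c⁻¹ ·)_* μ_pi = |c|_𝔸^{n²} μ_pi` (Tate's `d(cx) = |c| dx` in each of the `n²` coordinates).
[cite: TateThesis1967, Lemma 4.1.2] -/
theorem pi_map_inv_smul_eq [MeasurableSpace (AdeleRing (𝓞 K) K)] [BorelSpace (AdeleRing (𝓞 K) K)]
    (μ₁ : Measure (AdeleRing (𝓞 K) K)) [μ₁.IsAddHaarMeasure] [μ₁.Regular] (c : (AdeleRing (𝓞 K) K)ˣ) :
    (Measure.pi fun _ : Fin n => Measure.pi fun _ : Fin n => μ₁).map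
        (fun X : Fin n → Fin n → AdeleRing (𝓞 K) K => fun i j => ((c⁻¹ : (AdeleRing (𝓞 K) K)ˣ) : AdeleRing (𝓞 K) K) * X i j) =
      ((IdeleClassGroup.ideleNorm K c : ℝ≥0∞) ^ (n * n)) • Measure.pi fun _ : Fin n => Measure.pi fun _ : Fin n => μ₁ := by
  haveI : LocallyCompactSpace (AdeleRing (𝓞 K) K) := locallyCompactSpace_adeleRing' K
  haveI : SecondCountableTopology (AdeleRing (𝓞 K) K) := secondCountableTopology_adeleRing K
  have hg : Measurable fun x : AdeleRing (𝓞 K) K => ((c⁻¹ : (AdeleRing (𝓞 K) K)ˣ) : AdeleRing (𝓞 K) K) * x := measurable_const_mul _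
  have h1 : μ₁.map (fun x => ((c⁻¹ : (AdeleRing (𝓞 K) K)ˣ) : AdeleRing (𝓞 K) K) * x) = (IdeleClassGroup.ideleNorm K c : ℝ≥0∞) • μ₁ := by
    ext s hs
    rw [map_apply hg hs, Measure.smul_apply, smul_eq_mul]
    have hpre : (fun x => ((c⁻¹ : (AdeleRing (𝓞 K) K)ˣ) : AdeleRing (𝓞 K) K) * x) ⁻¹' s = c • s := by
      ext x
      rw [Set.mem_preimage, Set.mem_smul_set_iff_inv_smul_mem, Units.smul_def, smul_eq_mul]
    rw [hpre, AdeleRing.addHaar_smul_eq_ideleNorm_mul K μ₁ c s]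
  have ht0 : (IdeleClassGroup.ideleNorm K c : ℝ≥0∞) ≠ 0 := by
    have h : IdeleClassGroup.ideleNorm K c * IdeleClassGroup.ideleNorm K c⁻¹ = 1 := by rw [← map_mul, mul_inv_cancel, map_one]
    exact_mod_cast left_ne_zero_of_mul_eq_one h
  have h2 := pi_map_eq_pow_smul μ₁ hg ht0 ENNReal.coe_ne_top h1 n
  have hf : Measurable fun row : Fin n → AdeleRing (𝓞 K) K => fun j => ((c⁻¹ : (AdeleRing (𝓞 K) K)ˣ) : AdeleRing (𝓞 K) K) * row j :=
    measurable_pi_lambda _ fun j => hg.comp (measurable_pi_apply j)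
  have h3 := pi_map_eq_pow_smul (Measure.pi fun _ : Fin n => μ₁) hf (pow_ne_zero _ ht0) (ENNReal.pow_ne_top ENNReal.coe_ne_top) h2 n
  rw [← pow_mul] at h3
  exact h3

/-- `|r · (σ r)|_𝔸 = |r|_𝔸²` for a Galois automorphism `σ` (★ Galois invariance of the idele norm). [cite: TateThesis1967, Lemma 4.1.2] -/
theorem ideleNorm_mul_galConj {F : Type} [Field F] [Algebra F K] (σ : K ≃ₐ[F] K) (r : (AdeleRing (𝓞 K) K)ˣ) :
    IdeleClassGroup.ideleNorm K (r * Units.map (MulSemiringAction.toRingHom (K ≃ₐ[F] K) (AdeleRing (𝓞 K) K) σ :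
        AdeleRing (𝓞 K) K →* AdeleRing (𝓞 K) K) r) = IdeleClassGroup.ideleNorm K r ^ 2 := by
  refine NNReal.coe_injective ?_
  rw [map_mul, NNReal.coe_mul, NNReal.coe_pow, coe_ideleNorm, coe_ideleNorm, ideleNorm_unitsMap_galRingHom F σ r, sq]

end Adelic

/-! ## §3 The centre scaling of the Haar measure of `N_Δ(𝔸)` -/

section Doubled

variable (L : Type) [Field L] [NumberField L] [IsCMField L]
variable {N M n : ℕ} (e : Fin N × Fin M ≃ Fin n)
  (dV : Fin N → L) (hdV : ∀ i, IsCMField.complexConj L (dV i) = dV i)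
  (dW : Fin M → L) (hdW : ∀ i, IsCMField.complexConj L (dW i) = dW i)

/-- A CM field has an element `δ ≠ 0` with `c δ = −δ`. [folklore] -/
theorem exists_complexConj_eq_neg : ∃ δ : L, δ ≠ 0 ∧ IsCMField.complexConj L δ = -δ := by
  obtain ⟨x, hx⟩ : ∃ x : L, IsCMField.complexConj L x ≠ x := by
    by_contra h
    exact IsCMField.complexConj_ne_one (K := L) (AlgEquiv.ext fun x => not_not.1 fun hx => h ⟨x, hx⟩)
  refine ⟨x - IsCMField.complexConj L x, sub_ne_zero.2 (Ne.symm hx), ?_⟩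
  rw [map_sub, IsCMField.complexConj_apply_apply, neg_sub]

/-- `M ↦ blkB M` is continuous. [folklore] -/
theorem continuous_blkB {R : Type*} [CommRing R] [TopologicalSpace R] [IsTopologicalRing R] [Invertible (2 : R)] {ι : Type*} :
    Continuous (blkB : Matrix (ι ⊕ ι) (ι ⊕ ι) R → Matrix ι ι R) := by
  refine continuous_matrix fun i j => ?_
  simp only [blkB, Matrix.smul_apply, Matrix.add_apply, Matrix.sub_apply, Matrix.toBlocks₁₁, Matrix.toBlocks₁₂, Matrix.toBlocks₂₁,
    Matrix.toBlocks₂₂, Matrix.of_apply, smul_eq_mul]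
  have h : ∀ a b : ι ⊕ ι, Continuous fun M : Matrix (ι ⊕ ι) (ι ⊕ ι) R => M a b := fun a b =>
    (continuous_apply b).comp (continuous_apply a)
  exact continuous_const.mul ((((h _ _).sub (h _ _)).add (h _ _)).sub (h _ _))

set_option maxHeartbeats 400000 in
/-- **THE SQUARING CHART `Ψ X = (υ X, υ (δ⁻¹ X)) : M_n(𝔸_L) ≃ₜ N_Δ × N_Δ`** (`M_n = S ⊕ δ S` for the skew matrices `S`, `c δ = −δ`):
an additive-to-multiplicative homeomorphic isomorphism intertwining `X ↦ c_s⁻¹ X` with `conj × conj` along the split centre.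
[cite: Garrett2018, §3.10] -/
theorem exists_squaringChart (hdV0 : ∀ i, dV i ≠ 0) (hdW0 : ∀ i, dW i ≠ 0)
    {Mg Ng : Subgroup (siegelDelta L e dV hdV dW hdW : Subgroup (HA L e dV hdV dW hdW))}
    {eMN : ↥Mg × ↥Ng ≃ₜ (siegelDelta L e dV hdV dW hdW : Subgroup (HA L e dV hdV dW hdW))}
    (hS : IsTopSemidirect Mg Ng eMN) (φ : GL (Fin n) (AdeleRing (𝓞 L) L) ≃ₜ* ↥Mg)
    (hNg : ∀ p : (siegelDelta L e dV hdV dW hdW : Subgroup (HA L e dV hdV dW hdW)),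
      p ∈ Ng ↔ blkA (blk L e dV hdV dW hdW (p : HA L e dV hdV dW hdW)) = 1)
    (hNgD : ∀ p : (siegelDelta L e dV hdV dW hdW : Subgroup (HA L e dV hdV dW hdW)),
      p ∈ Ng → blkD (blk L e dV hdV dW hdW (p : HA L e dV hdV dW hdW)) = 1)
    (hφ : ∀ g : GL (Fin n) (AdeleRing (𝓞 L) L),
      blk L e dV hdV dW hdW (((φ g : ↥Mg) : (siegelDelta L e dV hdV dW hdW : Subgroup (HA L e dV hdV dW hdW))) : HA L e dV hdV dW hdW) =
        cayR (AdeleRing (𝓞 L) L) (Fin n) * Matrix.fromBlocks (g : Matrix (Fin n) (Fin n) (AdeleRing (𝓞 L) L)) 0 0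
          (((gramR L e dV hdV dW hdW).map ((algebraMap L (AdeleRing (𝓞 L) L)).comp (algebraMap (Fp L) L)))⁻¹ *
            (((g⁻¹ : GL (Fin n) (AdeleRing (𝓞 L) L)) : Matrix (Fin n) (Fin n) (AdeleRing (𝓞 L) L)).map
              (conjAdele (Fp L) L (IsCMField.complexConj L)))ᵀ *
            (gramR L e dV hdV dW hdW).map ((algebraMap L (AdeleRing (𝓞 L) L)).comp (algebraMap (Fp L) L))) *
          cayRinv (AdeleRing (𝓞 L) L) (Fin n)) :
    ∃ Ψ : Matrix (Fin n) (Fin n) (AdeleRing (𝓞 L) L) ≃ₜ ↥Ng × ↥Ng, (∀ X Y, Ψ (X + Y) = Ψ X * Ψ Y) ∧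
      ∀ (s : ℝ) (X : Matrix (Fin n) (Fin n) (AdeleRing (𝓞 L) L)),
        Ψ ((((posRealIdele L (expUnitNNReal s) *
              Units.map (conjAdele (Fp L) L (IsCMField.complexConj L) : AdeleRing (𝓞 L) L →* AdeleRing (𝓞 L) L)
                (posRealIdele L (expUnitNNReal s)))⁻¹ : (AdeleRing (𝓞 L) L)ˣ) : AdeleRing (𝓞 L) L) • X) =
          (hS.conjBy (φ (scalarExp n L s)) (Ψ X).1, hS.conjBy (φ (scalarExp n L s)) (Ψ X).2) := by
  obtain ⟨υ, hυc, hυblk, hυadd, hυB, hυconj⟩ := exists_unipotentChart L e dV hdV dW hdW hdV0 hdW0 hS φ hNg hNgD hφ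
  clear hφ hNg
  have hT : IsUnit ((gramR L e dV hdV dW hdW).map ((algebraMap L (AdeleRing (𝓞 L) L)).comp (algebraMap (Fp L) L))).det := isUnit_det_gramRA L e dV hdV dW hdW hdV0 hdW0
  have hTσ : ((gramR L e dV hdV dW hdW).map ((algebraMap L (AdeleRing (𝓞 L) L)).comp (algebraMap (Fp L) L))).map (conjAdele (Fp L) L (IsCMField.complexConj L)) = ((gramR L e dV hdV dW hdW).map ((algebraMap L (AdeleRing (𝓞 L) L)).comp (algebraMap (Fp L) L))) := gramRA_map_conjAdele L e dV hdV dW hdW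
  have hTt : ((gramR L e dV hdV dW hdW).map ((algebraMap L (AdeleRing (𝓞 L) L)).comp (algebraMap (Fp L) L)))ᵀ = ((gramR L e dV hdV dW hdW).map ((algebraMap L (AdeleRing (𝓞 L) L)).comp (algebraMap (Fp L) L))) := gramRA_transpose L e dV hdV dW hdW
  have hσσ : ∀ x, (conjAdele (Fp L) L (IsCMField.complexConj L)) ((conjAdele (Fp L) L (IsCMField.complexConj L)) x) = x := conjAdele_conjAdele' L
  have hex := exists_complexConj_eq_neg L
  have hδ0 : hex.choose ≠ 0 := hex.choose_spec.1
  have hδc : IsCMField.complexConj L hex.choose = -hex.choose := hex.choose_spec.2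
  have hdd' : (algebraMap L (AdeleRing (𝓞 L) L) hex.choose) * (algebraMap L (AdeleRing (𝓞 L) L) hex.choose⁻¹) = 1 := by rw [← map_mul, mul_inv_cancel₀ hδ0, map_one]
  have hd'd : (algebraMap L (AdeleRing (𝓞 L) L) hex.choose⁻¹) * (algebraMap L (AdeleRing (𝓞 L) L) hex.choose) = 1 := by rw [mul_comm, hdd']
  have hsd : (conjAdele (Fp L) L (IsCMField.complexConj L)) (algebraMap L (AdeleRing (𝓞 L) L) hex.choose) = -(algebraMap L (AdeleRing (𝓞 L) L) hex.choose) := by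
    rw [← algebraMap_conj, show ((IsCMField.complexConj L : L ≃ₐ[Fp L] L) : L →+* L) hex.choose = IsCMField.complexConj L hex.choose from rfl,
      hδc, map_neg]
  have hsd' : (conjAdele (Fp L) L (IsCMField.complexConj L)) (algebraMap L (AdeleRing (𝓞 L) L) hex.choose⁻¹) = -(algebraMap L (AdeleRing (𝓞 L) L) hex.choose⁻¹) := by
    rw [← algebraMap_conj, show ((IsCMField.complexConj L : L ≃ₐ[Fp L] L) : L →+* L) hex.choose⁻¹ = IsCMField.complexConj L hex.choose⁻¹ from rfl,
      map_inv₀, hδc, inv_neg, map_neg]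
  have hB : ∀ u : ↥Ng, ((blkB (blk L e dV hdV dW hdW ((u : (siegelDelta L e dV hdV dW hdW : Subgroup (HA L e dV hdV dW hdW))) : HA L e dV hdV dW hdW))).map (conjAdele (Fp L) L (IsCMField.complexConj L)))ᵀ * ((gramR L e dV hdV dW hdW).map ((algebraMap L (AdeleRing (𝓞 L) L)).comp (algebraMap (Fp L) L))) + ((gramR L e dV hdV dW hdW).map ((algebraMap L (AdeleRing (𝓞 L) L)).comp (algebraMap (Fp L) L))) * blkB (blk L e dV hdV dW hdW ((u : (siegelDelta L e dV hdV dW hdW : Subgroup (HA L e dV hdV dW hdW))) : HA L e dV hdV dW hdW)) = 0 :=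
    fun u => skew_blkB L e dV hdV dW hdW (hNgD _ u.2)
  have hext : ∀ {x y : ↥Ng}, ((x : (siegelDelta L e dV hdV dW hdW : Subgroup (HA L e dV hdV dW hdW))) : HA L e dV hdV dW hdW) = ((y : (siegelDelta L e dV hdV dW hdW : Subgroup (HA L e dV hdV dW hdW))) : HA L e dV hdV dW hdW) → x = y := fun h => Subtype.ext (Subtype.ext h)
  have hblkB : ∀ X, blkB (blk L e dV hdV dW hdW (((υ X : ↥Ng) : (siegelDelta L e dV hdV dW hdW : Subgroup (HA L e dV hdV dW hdW))) : HA L e dV hdV dW hdW)) = ⅟(2 : AdeleRing (𝓞 L) L) • (X + -(((gramR L e dV hdV dW hdW).map ((algebraMap L (AdeleRing (𝓞 L) L)).comp (algebraMap (Fp L) L)))⁻¹ * (X.map (conjAdele (Fp L) L (IsCMField.complexConj L)))ᵀ * ((gramR L e dV hdV dW hdW).map ((algebraMap L (AdeleRing (𝓞 L) L)).comp (algebraMap (Fp L) L))))) :=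
    fun X => by rw [hυblk X]; exact (blk_unip _).2.1
  have hυ0 : υ 0 = 1 := by
    have h := hυadd 0 0
    rw [add_zero] at h
    exact mul_left_cancel (h.symm.trans (mul_one _).symm)
  have hanti : ∀ {d : AdeleRing (𝓞 L) L} (_ : (conjAdele (Fp L) L (IsCMField.complexConj L)) d = -d) {Y : Matrix (Fin n) (Fin n) (AdeleRing (𝓞 L) L)}
      (_ : (Y.map (conjAdele (Fp L) L (IsCMField.complexConj L)))ᵀ * ((gramR L e dV hdV dW hdW).map ((algebraMap L (AdeleRing (𝓞 L) L)).comp (algebraMap (Fp L) L))) + ((gramR L e dV hdV dW hdW).map ((algebraMap L (AdeleRing (𝓞 L) L)).comp (algebraMap (Fp L) L))) * Y = 0), υ (d • Y) = 1 := by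
    intro d hd Y hY
    have hb := hblkB (d • Y)
    rw [proj_smul_of_anti hT hd hY] at hb
    have hu := hυB (υ (d • Y))
    rw [hb, hυ0] at hu
    exact hu.symm
  have hcoec : Continuous fun u : ↥Ng => blkB (blk L e dV hdV dW hdW ((u : (siegelDelta L e dV hdV dW hdW : Subgroup (HA L e dV hdV dW hdW))) : HA L e dV hdV dW hdW)) :=
    (continuous_blkB (R := AdeleRing (𝓞 L) L) (ι := Fin n)).comp
      ((((Units.continuous_val.comp continuous_subtype_val).matrix_submatrix _ _).comp continuous_subtype_val).comp continuous_subtype_val)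
  have hleft : Function.LeftInverse
      (fun q : ↥Ng × ↥Ng => blkB (blk L e dV hdV dW hdW ((q.1 : (siegelDelta L e dV hdV dW hdW : Subgroup (HA L e dV hdV dW hdW))) : HA L e dV hdV dW hdW)) + (algebraMap L (AdeleRing (𝓞 L) L) hex.choose) • blkB (blk L e dV hdV dW hdW ((q.2 : (siegelDelta L e dV hdV dW hdW : Subgroup (HA L e dV hdV dW hdW))) : HA L e dV hdV dW hdW)))
      (fun X : Matrix (Fin n) (Fin n) (AdeleRing (𝓞 L) L) => (υ X, υ ((algebraMap L (AdeleRing (𝓞 L) L) hex.choose⁻¹) • X))) := fun X => by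
    change blkB _ + (algebraMap L (AdeleRing (𝓞 L) L) hex.choose) • blkB _ = X
    rw [hblkB, hblkB]
    exact (self_eq_proj_add_smul_proj
      (T := (gramR L e dV hdV dW hdW).map ((algebraMap L (AdeleRing (𝓞 L) L)).comp (algebraMap (Fp L) L))) hsd' hdd' X).symm
  have hright : Function.RightInverse
      (fun q : ↥Ng × ↥Ng => blkB (blk L e dV hdV dW hdW ((q.1 : (siegelDelta L e dV hdV dW hdW : Subgroup (HA L e dV hdV dW hdW))) : HA L e dV hdV dW hdW)) + (algebraMap L (AdeleRing (𝓞 L) L) hex.choose) • blkB (blk L e dV hdV dW hdW ((q.2 : (siegelDelta L e dV hdV dW hdW : Subgroup (HA L e dV hdV dW hdW))) : HA L e dV hdV dW hdW)))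
      (fun X : Matrix (Fin n) (Fin n) (AdeleRing (𝓞 L) L) => (υ X, υ ((algebraMap L (AdeleRing (𝓞 L) L) hex.choose⁻¹) • X))) := fun q => by
    obtain ⟨u₁, u₂⟩ := q
    refine Prod.ext ?_ ?_
    · change υ (blkB _ + (algebraMap L (AdeleRing (𝓞 L) L) hex.choose) • blkB _) = u₁
      rw [hυadd, hυB, hanti hsd (hB u₂), mul_one]
    · change υ ((algebraMap L (AdeleRing (𝓞 L) L) hex.choose⁻¹) • (blkB _ + (algebraMap L (AdeleRing (𝓞 L) L) hex.choose) • blkB _)) = u₂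
      rw [smul_add, smul_smul, hd'd, one_smul, hυadd, hanti hsd' (hB u₁), one_mul, hυB]
  refine ⟨⟨⟨fun X => (υ X, υ ((algebraMap L (AdeleRing (𝓞 L) L) hex.choose⁻¹) • X)), fun q => blkB (blk L e dV hdV dW hdW ((q.1 : (siegelDelta L e dV hdV dW hdW : Subgroup (HA L e dV hdV dW hdW))) : HA L e dV hdV dW hdW)) + (algebraMap L (AdeleRing (𝓞 L) L) hex.choose) • blkB (blk L e dV hdV dW hdW ((q.2 : (siegelDelta L e dV hdV dW hdW : Subgroup (HA L e dV hdV dW hdW))) : HA L e dV hdV dW hdW)),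
    hleft, hright⟩, hυc.prodMk (hυc.comp (continuous_const_smul (algebraMap L (AdeleRing (𝓞 L) L) hex.choose⁻¹))),
    (hcoec.comp continuous_fst).add ((hcoec.comp continuous_snd).const_smul (algebraMap L (AdeleRing (𝓞 L) L) hex.choose))⟩, fun X Y => ?_, fun s X => ?_⟩
  · change (υ (X + Y), υ ((algebraMap L (AdeleRing (𝓞 L) L) hex.choose⁻¹) • (X + Y))) = (υ X * υ Y, υ ((algebraMap L (AdeleRing (𝓞 L) L) hex.choose⁻¹) • X) * υ ((algebraMap L (AdeleRing (𝓞 L) L) hex.choose⁻¹) • Y))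
    rw [hυadd, smul_add, hυadd]
  · change (υ ((((posRealIdele L (expUnitNNReal s) * Units.map (conjAdele (Fp L) L (IsCMField.complexConj L) : AdeleRing (𝓞 L) L →* AdeleRing (𝓞 L) L) (posRealIdele L (expUnitNNReal s)))⁻¹ : (AdeleRing (𝓞 L) L)ˣ) : AdeleRing (𝓞 L) L) • X), υ ((algebraMap L (AdeleRing (𝓞 L) L) hex.choose⁻¹) • ((((posRealIdele L (expUnitNNReal s) * Units.map (conjAdele (Fp L) L (IsCMField.complexConj L) : AdeleRing (𝓞 L) L →* AdeleRing (𝓞 L) L) (posRealIdele L (expUnitNNReal s)))⁻¹ : (AdeleRing (𝓞 L) L)ˣ) : AdeleRing (𝓞 L) L) • X))) =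
      (hS.conjBy (φ (scalarExp n L s)) (υ X), hS.conjBy (φ (scalarExp n L s)) (υ ((algebraMap L (AdeleRing (𝓞 L) L) hex.choose⁻¹) • X)))
    have hcomm : (algebraMap L (AdeleRing (𝓞 L) L) hex.choose⁻¹) • ((((posRealIdele L (expUnitNNReal s) * Units.map (conjAdele (Fp L) L (IsCMField.complexConj L) : AdeleRing (𝓞 L) L →* AdeleRing (𝓞 L) L) (posRealIdele L (expUnitNNReal s)))⁻¹ : (AdeleRing (𝓞 L) L)ˣ) : AdeleRing (𝓞 L) L) • X) = (((posRealIdele L (expUnitNNReal s) * Units.map (conjAdele (Fp L) L (IsCMField.complexConj L) : AdeleRing (𝓞 L) L →* AdeleRing (𝓞 L) L) (posRealIdele L (expUnitNNReal s)))⁻¹ : (AdeleRing (𝓞 L) L)ˣ) : AdeleRing (𝓞 L) L) • ((algebraMap L (AdeleRing (𝓞 L) L) hex.choose⁻¹) • X) := by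
      ext i j
      rw [Matrix.smul_apply, Matrix.smul_apply, Matrix.smul_apply, Matrix.smul_apply, smul_eq_mul, smul_eq_mul, smul_eq_mul, smul_eq_mul,
        mul_left_comm]
    exact Prod.ext (hυconj s X).symm ((congrArg υ hcomm).trans (hυconj s ((algebraMap L (AdeleRing (𝓞 L) L) hex.choose⁻¹) • X)).symm)

/-- **THE CENTRE SCALING** (`dV, dW ≠ 0`, `H(𝔸)` with its Borel structure).  For the Siegel–Levi chart `(M_Δ, N_Δ, e, φ)` (through its
characterisation, ★ `exists_siegelLeviChart`) there is a Haar measure `μ_N` on `N_Δ` with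
`((φ z(eˢ))⁻¹ · φ z(eˢ))_* μ_N = e^{(n² [L:ℚ]) s} μ_N` for all real `s` (★ `IsTopSemidirect.conjBy`).
[cite: Garrett2018, §3.10] [cite: MoeglinWaldspurger1995, II.1.5] -/
theorem exists_haar_conjBy_scaling [MeasurableSpace (HA L e dV hdV dW hdW)] [BorelSpace (HA L e dV hdV dW hdW)]
    (hdV0 : ∀ i, dV i ≠ 0) (hdW0 : ∀ i, dW i ≠ 0)
    {Mg Ng : Subgroup (siegelDelta L e dV hdV dW hdW : Subgroup (HA L e dV hdV dW hdW))}
    {eMN : ↥Mg × ↥Ng ≃ₜ (siegelDelta L e dV hdV dW hdW : Subgroup (HA L e dV hdV dW hdW))}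
    (hS : IsTopSemidirect Mg Ng eMN) (φ : GL (Fin n) (AdeleRing (𝓞 L) L) ≃ₜ* ↥Mg)
    (hNg : ∀ p : (siegelDelta L e dV hdV dW hdW : Subgroup (HA L e dV hdV dW hdW)),
      p ∈ Ng ↔ blkA (blk L e dV hdV dW hdW (p : HA L e dV hdV dW hdW)) = 1)
    (hNgD : ∀ p : (siegelDelta L e dV hdV dW hdW : Subgroup (HA L e dV hdV dW hdW)),
      p ∈ Ng → blkD (blk L e dV hdV dW hdW (p : HA L e dV hdV dW hdW)) = 1)
    (hφ : ∀ g : GL (Fin n) (AdeleRing (𝓞 L) L),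
      blk L e dV hdV dW hdW (((φ g : ↥Mg) : (siegelDelta L e dV hdV dW hdW : Subgroup (HA L e dV hdV dW hdW))) : HA L e dV hdV dW hdW) =
        cayR (AdeleRing (𝓞 L) L) (Fin n) * Matrix.fromBlocks (g : Matrix (Fin n) (Fin n) (AdeleRing (𝓞 L) L)) 0 0
          (((gramR L e dV hdV dW hdW).map ((algebraMap L (AdeleRing (𝓞 L) L)).comp (algebraMap (Fp L) L)))⁻¹ *
            (((g⁻¹ : GL (Fin n) (AdeleRing (𝓞 L) L)) : Matrix (Fin n) (Fin n) (AdeleRing (𝓞 L) L)).map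
              (conjAdele (Fp L) L (IsCMField.complexConj L)))ᵀ *
            (gramR L e dV hdV dW hdW).map ((algebraMap L (AdeleRing (𝓞 L) L)).comp (algebraMap (Fp L) L))) *
          cayRinv (AdeleRing (𝓞 L) L) (Fin n)) :
    ∃ μN : Measure ↥Ng, μN.IsHaarMeasure ∧ ∀ s : ℝ,
      μN.map (hS.conjBy (φ (scalarExp n L s))) = ENNReal.ofReal (Real.exp (((n * n * Module.finrank ℚ L : ℕ) : ℝ) * s)) • μN := by
  haveI : T2Space (GL (Fin (n + n)) (AdeleRing (𝓞 L) L)) := t2Space_gl (n + n) L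
  haveI : LocallyCompactSpace (siegelDelta L e dV hdV dW hdW : Subgroup (HA L e dV hdV dW hdW)) := (isClosed_siegelDelta L e dV hdV dW hdW).locallyCompactSpace
  haveI : SecondCountableTopology (siegelDelta L e dV hdV dW hdW : Subgroup (HA L e dV hdV dW hdW)) := TopologicalSpace.Subtype.secondCountableTopology _
  haveI : LocallyCompactSpace ↥Mg := hS.isClosed_left.locallyCompactSpace
  haveI : LocallyCompactSpace ↥Ng := hS.isClosed_right.locallyCompactSpace
  haveI : SecondCountableTopology ↥Ng := TopologicalSpace.Subtype.secondCountableTopology _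
  -- the squaring chart (before anything else, to keep unification cheap)
  obtain ⟨Ψ, hΨadd, hΨm⟩ := exists_squaringChart L e dV hdV dW hdW hdV0 hdW0 hS φ hNg hNgD hφ
  clear hφ hNg hNgD
  refine ⟨haar, inferInstance, fun s => ?_⟩
  have hθ := hS.map_conjBy_eq_smul (haar : Measure ↥Ng) (φ (scalarExp n L s))
  rw [hθ]
  obtain ⟨θ, hθdef⟩ : ∃ θ : ℝ≥0, θ = modularCharacter (((φ (scalarExp n L s) : ↥Mg) : (siegelDelta L e dV hdV dW hdW : Subgroup (HA L e dV hdV dW hdW)))) * (modularCharacter (φ (scalarExp n L s)))⁻¹ := ⟨_, rfl⟩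
  rw [← hθdef] at hθ ⊢
  suffices hθval : θ = (IdeleClassGroup.ideleNorm L (posRealIdele L (expUnitNNReal s))) ^ (n * n) by
    congr 1
    rw [hθval, ENNReal.ofReal, ENNReal.coe_inj]
    refine NNReal.eq ?_
    rw [NNReal.coe_pow, ideleNorm_posRealIdele_holds L (expUnitNNReal s), NNReal.coe_pow, coe_expUnitNNReal, ← Real.exp_nat_mul,
      ← Real.exp_nat_mul, Real.coe_toNNReal _ (Real.exp_pos _).le]
    congr 1; push_cast; ring
  obtain ⟨c, hc⟩ : ∃ c : (AdeleRing (𝓞 L) L)ˣ, c = posRealIdele L (expUnitNNReal s) *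
      Units.map (conjAdele (Fp L) L (IsCMField.complexConj L) : AdeleRing (𝓞 L) L →* AdeleRing (𝓞 L) L) (posRealIdele L (expUnitNNReal s)) :=
    ⟨_, rfl⟩
  obtain ⟨cA, hcA⟩ : ∃ cA : AdeleRing (𝓞 L) L, cA = ((c⁻¹ : (AdeleRing (𝓞 L) L)ˣ) : AdeleRing (𝓞 L) L) := ⟨_, rfl⟩
  have hΨm' : ∀ X, Ψ (cA • X) = (hS.conjBy (φ (scalarExp n L s)) (Ψ X).1, hS.conjBy (φ (scalarExp n L s)) (Ψ X).2) := fun X => by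
    rw [hcA, hc]; exact hΨm s X
  clear hΨm
  haveI : SecondCountableTopology (AdeleRing (𝓞 L) L) := secondCountableTopology_adeleRing L
  haveI : LocallyCompactSpace (AdeleRing (𝓞 L) L) := locallyCompactSpace_adeleRing' L
  letI : MeasurableSpace (AdeleRing (𝓞 L) L) := borel _
  haveI : BorelSpace (AdeleRing (𝓞 L) L) := ⟨rfl⟩
  letI : MeasurableSpace (Matrix (Fin n) (Fin n) (AdeleRing (𝓞 L) L)) := inferInstanceAs (MeasurableSpace (Fin n → Fin n → AdeleRing (𝓞 L) L))
  haveI : BorelSpace (Matrix (Fin n) (Fin n) (AdeleRing (𝓞 L) L)) := inferInstanceAs (BorelSpace (Fin n → Fin n → AdeleRing (𝓞 L) L))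
  haveI : SecondCountableTopology (Matrix (Fin n) (Fin n) (AdeleRing (𝓞 L) L)) := inferInstanceAs (SecondCountableTopology (Fin n → Fin n → AdeleRing (𝓞 L) L))
  haveI : LocallyCompactSpace (Matrix (Fin n) (Fin n) (AdeleRing (𝓞 L) L)) := inferInstanceAs (LocallyCompactSpace (Fin n → Fin n → AdeleRing (𝓞 L) L))
  haveI : T2Space (AdeleRing (𝓞 L) L) := t2Space_adeleRing L
  haveI : T2Space (Matrix (Fin n) (Fin n) (AdeleRing (𝓞 L) L)) := inferInstanceAs (T2Space (Fin n → Fin n → AdeleRing (𝓞 L) L))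
  have hcb : Measurable (hS.conjBy (φ (scalarExp n L s))) := (hS.continuous_conjBy_right _).measurable
  have hm : Measurable fun X : Matrix (Fin n) (Fin n) (AdeleRing (𝓞 L) L) => cA • X := (continuous_const_smul cA).measurable
  obtain ⟨μV, hμV⟩ : ∃ μV : Measure (Matrix (Fin n) (Fin n) (AdeleRing (𝓞 L) L)), μV = ((haar : Measure ↥Ng).prod haar).map Ψ.symm := ⟨_, rfl⟩
  haveI hV1 : μV.IsAddLeftInvariant := hμV ▸ isAddLeftInvariant_transport (haar : Measure ↥Ng) Ψ hΨadd
  haveI hV2 : IsFiniteMeasureOnCompacts μV := hμV ▸ isFiniteMeasureOnCompacts_transport (haar : Measure ↥Ng) Ψ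
  have hV3 : μV.map (fun X => cA • X) = ((θ : ℝ≥0∞) * θ) • μV := hμV ▸ map_transport_eq_smul (haar : Measure ↥Ng) Ψ hcb hθ hm hΨm'
  obtain ⟨μ₁, hμ₁⟩ : ∃ μ₁ : Measure (AdeleRing (𝓞 L) L), μ₁ = addHaarMeasure (Classical.arbitrary _) := ⟨_, rfl⟩
  haveI : μ₁.IsAddHaarMeasure := by rw [hμ₁]; infer_instance
  haveI : μ₁.Regular := by rw [hμ₁]; infer_instance
  obtain ⟨μpi, hμpi⟩ : ∃ μpi : Measure (Matrix (Fin n) (Fin n) (AdeleRing (𝓞 L) L)),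
      μpi = (Measure.pi fun _ : Fin n => Measure.pi fun _ : Fin n => μ₁ : Measure (Fin n → Fin n → AdeleRing (𝓞 L) L)) := ⟨_, rfl⟩
  haveI hpi1 : IsAddHaarMeasure (Measure.pi fun _ : Fin n => μ₁) := Measure.pi.isAddHaarMeasure _
  haveI : IsAddHaarMeasure μpi := by
    rw [hμpi]
    exact (Measure.pi.isAddHaarMeasure _ : IsAddHaarMeasure (Measure.pi fun _ : Fin n => Measure.pi fun _ : Fin n => μ₁ :
      Measure (Fin n → Fin n → AdeleRing (𝓞 L) L)))
  have hpi : μpi.map (fun X => cA • X) = ((IdeleClassGroup.ideleNorm L c : ℝ≥0∞) ^ (n * n)) • μpi := by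
    have hfun : (fun X : Matrix (Fin n) (Fin n) (AdeleRing (𝓞 L) L) => cA • X) =
        fun X : Fin n → Fin n → AdeleRing (𝓞 L) L => fun i j => ((c⁻¹ : (AdeleRing (𝓞 L) L)ˣ) : AdeleRing (𝓞 L) L) * X i j := by
      funext X i j; rw [hcA]; rfl
    rw [hfun, hμpi]
    exact pi_map_inv_smul_eq L n μ₁ c
  have hκ : μV = addHaarScalarFactor μV μpi • μpi := isAddLeftInvariant_eq_smul μV μpi
  have hV4 : μV.map (fun X => cA • X) = ((IdeleClassGroup.ideleNorm L c : ℝ≥0∞) ^ (n * n)) • μV := by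
    conv_lhs => rw [hκ]
    rw [Measure.map_smul, hpi, smul_comm, ← hκ]
  obtain ⟨Kc, hKc, h0K⟩ := exists_compact_mem_nhds (0 : Matrix (Fin n) (Fin n) (AdeleRing (𝓞 L) L))
  have hpos : μV (interior Kc) ≠ 0 := by
    rw [hκ, Measure.smul_apply, ENNReal.smul_def, smul_eq_mul]
    refine mul_ne_zero ?_ (isOpen_interior.measure_pos μpi ⟨0, mem_interior_iff_mem_nhds.2 h0K⟩).ne'
    intro hκ0
    have hzero : μV Set.univ = 0 := by rw [hκ, Measure.smul_apply, ENNReal.smul_def, smul_eq_mul, hκ0, zero_mul]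
    rw [hμV, map_apply Ψ.symm.continuous.measurable MeasurableSet.univ, Set.preimage_univ] at hzero
    exact (isOpen_univ.measure_pos ((haar : Measure ↥Ng).prod haar) Set.univ_nonempty).ne' hzero
  have htop : μV (interior Kc) ≠ ∞ := (lt_of_le_of_lt (measure_mono interior_subset) hKc.measure_lt_top).ne
  have heq : ((θ : ℝ≥0∞) * θ) * μV (interior Kc) = ((IdeleClassGroup.ideleNorm L c : ℝ≥0∞) ^ (n * n)) * μV (interior Kc) := by
    have h := congrArg (fun μ : Measure (Matrix (Fin n) (Fin n) (AdeleRing (𝓞 L) L)) => μ (interior Kc)) (hV3.symm.trans hV4)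
    simpa only [Measure.smul_apply, smul_eq_mul] using h
  have hθsq : θ * θ = (IdeleClassGroup.ideleNorm L c) ^ (n * n) := by exact_mod_cast (ENNReal.mul_left_inj hpos htop).1 heq
  have hcnorm : IdeleClassGroup.ideleNorm L c = IdeleClassGroup.ideleNorm L (posRealIdele L (expUnitNNReal s)) ^ 2 :=
    hc ▸ ideleNorm_mul_galConj L (F := Fp L) (IsCMField.complexConj L) _
  rw [hcnorm, ← pow_mul, show 2 * (n * n) = (n * n) * 2 by ring, pow_mul, sq] at hθsq
  exact (pow_left_inj₀ (by positivity) (by positivity) two_ne_zero).1 (by rw [sq, sq, hθsq])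

end Doubled

end Summit.HodgeConjecture.HodgeConjecture.Cruxes.HLiu418.K2LiuSiegelDoubledUnipotentScaling

end
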